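import Summits.QuantumFields.YangMills.Theorems.BalabanUVNodesN22W1CouplingRadiiPhaseTower
import Summits.QuantumFields.YangMills.Theorems.BalabanUVNodesN22W1FadingMemoryOfCouplingRadiiVertex

/-!
# BalabanUVNodes ∕ node N22 = NE9 — THE VERTEX PHASE TOWER: a NON-TERMLESS model witness (A6) for the VERTEX edition of the coupling-analytic road
# (J31b's relative last-coupling discs + age-growing radii in the OLDER couplings; module `…N22W1FadingMemoryOfCouplingRadiiVertex` ★ fires on it non-trivially)

Cell `pub-ymgap`, HUMAN RULING D-0062 (Track A) ∕ D-0149, WIDTH SEAT `pub-ymgap-dag-n22-w1` (harness re-seat g3) on node n22 = NE9; `--kind proof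
--supports stmt-QuantumFields-20544 --as helper` (K3⁷ `SpineGivenEndpointR13SepCoPH`), COUNT-NEUTRAL.  THEOREMS ONLY (0 `def`, 0 `sorry`, standard axioms); imports
this seat's `…N22W1CouplingRadiiPhaseTower` (§1 phase lemmas) and g2's vertex module `…N22W1FadingMemoryOfCouplingRadiiVertex` (p609043) — through them dag-n22-c's
J31b (p606684), g0's Road-1 knit, dag-n22-e's `ne9_of_moduli_le`, node00-def-W1's `Node00.HistoryTermsOfRecord`, RR-1's `U3Letters₁₁`.

WHY.  The VERTEX edition is the cell's reading of print at the last coupling (pv10, `T4CouplingAnalyticity` (L5)∕[H-dil]): the last coupling `g_k` is a dilation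
parameter, NO `g`-independent complex margin about `]0, γ]` is claimed there; J31b ∕ g2's vertex ★ `ne9_and_fadingMemory_functionalOn_of_coordHoloRadii_vertex` read
instead holomorphy on the RELATIVE discs `D̄(s, c·s)` with a bound `A′·s·e^{−R d}` vanishing LINEARLY at the vertex, and age-growing radii in the OLDER couplings only.
Its only rider in the tree is TERMLESS (`ne9_and_fadingMemory_termlessTower_vertex`, J31b `coordHoloRel_termlessStep`: `H ≡ 0`).  THIS MODULE types the non-termless
model on which it fires NON-TRIVIALLY — the VERTEX PHASE TOWER: at step `k` ONE term per polymer,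
  `H(Z; g₀,…,g_k; φ) = A·e^{−2}·e^{−R d_{k+1}(Z)} · (g_k ∕ γ) · exp( i · Σ_{i<k} g_i · ω^{k+1−i} ∕ ϱ )`,
LINEAR IN THE LAST COUPLING (vanishing at the vertex — first order in `g_k`, print's dilation shape; no uniform last-coupling margin is used or claimed) and a PHASE in
the OLDER couplings whose sensitivity to `g_i` is `A e^{−2} e^{−Rd}·(g_k∕γ)·ω^{k+1−i}∕ϱ` (fading with the AGE).  In each older coordinate it extends to the strip
`|Im z| < 2ρ`, `ρ = ϱ·ω^{−(k+1−i)}`, bounded by `A e^{−R d}` (amplitude `A`: `g_k∕γ ≤ 1` on the box); in the last coordinate it is ENTIRE (`z ↦ (A e^{−2} e^{−Rd}∕γ)·z·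
e^{iθ_old}`), bounded on `D̄(s, c·s)` by `A′·s·e^{−R d}`, `A′ = A e^{−2}(1+c)∕γ` (`|z| ≤ (1+c)s`): the two data `hOld` ∕ `hLast` of g2's vertex ★ with the GEOMETRIC
radius table ON THE NOSE, so the ★ FIRES and gives node N22's shape `NE9 ∧ FadingMemory` with the vertex table `c₀·(if i+1<n then 4A·ω^{n−i}∕ϱ else 8A′∕min(c,1))`
— on a tower that reads every coupling, the last one at first order.  Characterised by its ACTIVITY FORMULA (`hS`); §3 EXHIBITS a realisation.

WHAT (all [folklore]: elementary complex analysis + by-name composition).  §1 ONE STEP under `hS` (any `P`, `𝔸`, `M`, `k`): `H_update_phaseStepVertex` (generic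
coordinate update), `H_update_last_phaseStepVertex` (the last coupling enters LINEARLY), `norm_H_phaseStepVertex` (`‖H‖ = A e^{−2} e^{−Rd}·|g_k|∕γ`),
`H_update_last_injective_phaseStepVertex` (distinct last couplings ⇒ distinct activities), `hasDerivAt_H_old_coord_phaseStepVertex` ∕ `norm_deriv_H_old_coord_…` (sensitivity
to an older coupling), ★ `coordHoloOld_phaseStepVertex` (g2-vertex `hOld` with radii `ϱ·(ω^{k+1−i})⁻¹`, amplitude `A`), ★ `coordHoloLast_phaseStepVertex` (g2-vertex `hLast`
on the relative discs, amplitude `A′ = A e^{−2}(1+c)∕γ`), `analyticH_and_localizedH_phaseStepVertex` (configuration slots, trivially — configuration-constant,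
declared).  §2 THE TOWER on
the `K`-th torus: `coordHoloOld_phaseTowerVertex` ∕ `coordHoloLast_phaseTowerVertex`, ★★ `ne9_and_fadingMemory_phaseTowerVertex` (g2's vertex ★ FIRES; numerals as there
with `A′ = A e^{−2}(1+c)∕γ`), `ne9_letterModuli_phaseTowerVertex` (the `ℓ.moduli` face).  §3 `exists_phaseTowerVertex` (index type `𝐃_{k+1}`, `idx Z = {Z}`) and ★★
`exists_nonTermless_ne9_and_fadingMemory_vertex` (PACKAGED A6: one term per polymer, activities of modulus `A e^{−2} e^{−Rd} g_k∕γ` — nonzero on the box, injective in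
the last coupling — carrying node N22's vertex shape).

HONEST FRAMING.  A MODEL tower, NOT NODE 00's objects: nothing of the record (N10's Lemmas 1–3, NODE A's towers ∕ readings, N09's `EHoloAt`, def-W1's `emb`) is claimed to
meet anything; the activities are CONFIGURATION-CONSTANT (declared; those slots are N10's ∕ NODE A's); the relative-disc last-coupling datum is the CELL's reading of print's
dilation, NOT a printed estimate; a model-level inhabitant books NO discharge.  Count-neutral A6 helper; N22 NOT discharged (typed 28∕28 · discharged 5∕27 UNCHANGED —
the chair's single count line is the only count); K3⁷ OPEN, NOT claimed; NE9 ∕ `FadingMemory` NOT IN PRINT for d = 4; one finite four-torus programme at fixed ε — R4 closes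
the CONDITIONAL rung `BalabanLadder.UV` only; NOT infinite volume ∕ OS on ℝ⁴ ∕ mass gap ∕ Clay.
References (TYPES only): [I] = [Balaban1987RG1] CMP **109** (1987) §1 p. 263 («C^∞ … (or analytic)» in the LAST coupling), §5 p. 298; [II] = [Balaban1988RG2Cluster]
CMP **116** (1988) (2.9)–(2.14) pp. 14–15 (the last coupling as dilation parameter of the step), Lemma 3 (2.38) p. 20.
-/

noncomputable section

namespace YMDAG.N22.W1.CouplingRadii.PhaseTowerVertex

open Set Metric
open scoped BigOperators
open Literature.MathematicalPhysics.QuantumFieldTheory.Balaban1983to89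
open Literature.MathematicalPhysics.QuantumFieldTheory.Balaban1983to89.T4Continuum (T4Family)
open Literature.MathematicalPhysics.QuantumFieldTheory.Balaban1983to89.T4OutputRate
open Literature.MathematicalPhysics.QuantumFieldTheory.Balaban1983to89.B12TreeDecay (K₀ K₀_pos)
open Literature.MathematicalPhysics.QuantumFieldTheory.Balaban1983to89.Node00
open Literature.MathematicalPhysics.QuantumFieldTheory.Balaban1983to89.Node00.Sect2 (domSys domCount CPair)
open Literature.MathematicalPhysics.QuantumFieldTheory.Balaban1983to89.Node00.W1
open YMDAG.N22.W1.CouplingRadii.PhaseTower (norm_cexp_I_mul_ofReal norm_cexp_I_mul_mul_ofReal_le cexp_I_sum_update)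

/-! ## §1 One step of the vertex phase tower -/

section Step
variable {P : Params} {𝔸 : Type*} {M k : ℕ} (S : ClusterStep P 𝔸 M k) {A R ϱ ω γ : ℝ}
variable (hS : ∀ (g : Fin (k + 1) → ℝ) (φ : CPair P 𝔸) (Z : (domSys P M (k + 1)).Dom),
  S.H g φ Z = ((A * Real.exp (-2) * Real.exp (-(R * (domSys P M (k + 1)).dj Z)) * (g (Fin.last k) / γ) : ℝ) : ℂ) *
    Complex.exp (Complex.I * ((∑ i : Fin (k + 1), g i * (if (i : ℕ) < k then ω ^ (k + 1 - (i : ℕ)) / ϱ else 0) : ℝ) : ℂ)))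
include hS

/-- **GENERIC COORDINATE UPDATE**: moving `g_i` to `t` updates the linear factor and multiplies the phase by `e^{i t c_i}` (`c_i = ω^{k+1−i}∕ϱ` for `i < k`, `c_k = 0`).
[folklore] -/
theorem H_update_phaseStepVertex (g : Fin (k + 1) → ℝ) (φ : CPair P 𝔸) (Z : (domSys P M (k + 1)).Dom) (i : Fin (k + 1)) (t : ℝ) :
    S.H (Function.update g i t) φ Z =
      ((A * Real.exp (-2) * Real.exp (-(R * (domSys P M (k + 1)).dj Z)) * (Function.update g i t (Fin.last k) / γ) : ℝ) : ℂ) *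
        Complex.exp (Complex.I * ((∑ j : Fin (k + 1), Function.update g i 0 j *
          (if (j : ℕ) < k then ω ^ (k + 1 - (j : ℕ)) / ϱ else 0) : ℝ) : ℂ)) *
        Complex.exp (Complex.I * ((t : ℂ) * ((if (i : ℕ) < k then ω ^ (k + 1 - (i : ℕ)) / ϱ else 0 : ℝ) : ℂ))) := by
  have h := cexp_I_sum_update g (fun j : Fin (k + 1) => if (j : ℕ) < k then ω ^ (k + 1 - (j : ℕ)) / ϱ else 0) i t
  beta_reduce at h
  rw [hS, h]
  exact (mul_assoc _ _ _).symm

/-- **THE LAST COUPLING ENTERS LINEARLY**: `H(Z; g|g_k := t) = t · (A e^{−2} e^{−Rd}∕γ) · e^{iθ_old(g)}` — the phase does not read `g_k`. [folklore] -/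
theorem H_update_last_phaseStepVertex (g : Fin (k + 1) → ℝ) (φ : CPair P 𝔸) (Z : (domSys P M (k + 1)).Dom) (t : ℝ) :
    S.H (Function.update g (Fin.last k) t) φ Z =
      (t : ℂ) * (((A * Real.exp (-2) * Real.exp (-(R * (domSys P M (k + 1)).dj Z)) / γ : ℝ) : ℂ) *
        Complex.exp (Complex.I * ((∑ j : Fin (k + 1), Function.update g (Fin.last k) 0 j *
          (if (j : ℕ) < k then ω ^ (k + 1 - (j : ℕ)) / ϱ else 0) : ℝ) : ℂ))) := by
  rw [H_update_phaseStepVertex S hS g φ Z (Fin.last k) t, Function.update_self, Fin.val_last, if_neg (lt_irrefl k)]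
  push_cast
  simp only [mul_zero, Complex.exp_zero, mul_one]
  ring

/-- **AN OLDER COUPLING `i < k` ENTERS THROUGH THE PHASE ONLY**: `H(Z; g|g_i := t) = H(Z; g|g_i := 0) · e^{i t ω^{k+1−i}∕ϱ}`. [folklore] -/
theorem H_update_old_phaseStepVertex (g : Fin (k + 1) → ℝ) (φ : CPair P 𝔸) (Z : (domSys P M (k + 1)).Dom) {i : Fin (k + 1)} (hi : (i : ℕ) < k)
    (t : ℝ) :
    S.H (Function.update g i t) φ Z =
      S.H (Function.update g i 0) φ Z * Complex.exp (Complex.I * ((t : ℂ) * ((ω ^ (k + 1 - (i : ℕ)) / ϱ : ℝ) : ℂ))) := by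
  have hne : Fin.last k ≠ i := by rintro rfl; simp at hi
  rw [H_update_phaseStepVertex S hS g φ Z i t, H_update_phaseStepVertex S hS g φ Z i 0, if_pos hi, Function.update_of_ne hne,
    Function.update_of_ne hne]
  push_cast
  simp only [zero_mul, mul_zero, Complex.exp_zero, mul_one]

/-- **EXACT MODULUS**: `‖H(Z; g; φ)‖ = A e^{−2} e^{−R d_{k+1}(Z)}·|g_k|∕γ` (`A ≥ 0`, `γ > 0`) — nonzero whenever `g_k ≠ 0`, in particular on the box `]0, γ]^{k+1}` (`A > 0`):
NOT termless. [folklore] -/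
theorem norm_H_phaseStepVertex (hA : 0 ≤ A) (hγ : 0 < γ) (g : Fin (k + 1) → ℝ) (φ : CPair P 𝔸) (Z : (domSys P M (k + 1)).Dom) :
    ‖S.H g φ Z‖ = A * Real.exp (-2) * Real.exp (-(R * (domSys P M (k + 1)).dj Z)) * (|g (Fin.last k)| / γ) := by
  rw [hS, norm_mul, norm_cexp_I_mul_ofReal, mul_one, Complex.norm_real, Real.norm_eq_abs, abs_mul, abs_of_nonneg (by positivity : 0 ≤ A * _ * _),
    abs_div, abs_of_pos hγ]

/-- **DISTINCT LAST COUPLINGS GIVE DISTINCT ACTIVITIES** (`A > 0`, `γ > 0`): `t ↦ H(Z; g|g_k := t; φ)` is injective — the dependence on the last coupling is genuine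
(and linear). [folklore] -/
theorem H_update_last_injective_phaseStepVertex (hA : 0 < A) (hγ : 0 < γ) (g : Fin (k + 1) → ℝ) (φ : CPair P 𝔸) (Z : (domSys P M (k + 1)).Dom) :
    Function.Injective fun t : ℝ => S.H (Function.update g (Fin.last k) t) φ Z := by
  intro t t' h
  have hne : (((A * Real.exp (-2) * Real.exp (-(R * (domSys P M (k + 1)).dj Z)) / γ : ℝ) : ℂ) *
      Complex.exp (Complex.I * ((∑ j : Fin (k + 1), Function.update g (Fin.last k) 0 j *
        (if (j : ℕ) < k then ω ^ (k + 1 - (j : ℕ)) / ϱ else 0) : ℝ) : ℂ))) ≠ 0 := by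
    refine mul_ne_zero ?_ (Complex.exp_ne_zero _)
    exact_mod_cast (by positivity : (A * Real.exp (-2) * Real.exp (-(R * (domSys P M (k + 1)).dj Z)) / γ) ≠ 0)
  have key : (t : ℂ) * (((A * Real.exp (-2) * Real.exp (-(R * (domSys P M (k + 1)).dj Z)) / γ : ℝ) : ℂ) *
      Complex.exp (Complex.I * ((∑ j : Fin (k + 1), Function.update g (Fin.last k) 0 j *
        (if (j : ℕ) < k then ω ^ (k + 1 - (j : ℕ)) / ϱ else 0) : ℝ) : ℂ))) =
      (t' : ℂ) * (((A * Real.exp (-2) * Real.exp (-(R * (domSys P M (k + 1)).dj Z)) / γ : ℝ) : ℂ) *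
      Complex.exp (Complex.I * ((∑ j : Fin (k + 1), Function.update g (Fin.last k) 0 j *
        (if (j : ℕ) < k then ω ^ (k + 1 - (j : ℕ)) / ϱ else 0) : ℝ) : ℂ))) := by
    simpa only [H_update_last_phaseStepVertex S hS] using h
  exact_mod_cast mul_right_cancel₀ hne key

/-- **THE SENSITIVITY TO AN OLDER COUPLING `g_i`, `i < k`**: derivative `H(Z; g|g_i := t; φ) · i·ω^{k+1−i}∕ϱ` at every real `t`. [folklore] -/
theorem hasDerivAt_H_old_coord_phaseStepVertex (g : Fin (k + 1) → ℝ) (φ : CPair P 𝔸) (Z : (domSys P M (k + 1)).Dom) {i : Fin (k + 1)} (hi : (i : ℕ) < k)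
    (t : ℝ) :
    HasDerivAt (fun s : ℝ => S.H (Function.update g i s) φ Z)
      (S.H (Function.update g i t) φ Z * (Complex.I * ((ω ^ (k + 1 - (i : ℕ)) / ϱ : ℝ) : ℂ))) t := by
  have hfun : (fun s : ℝ => S.H (Function.update g i s) φ Z) = fun s : ℝ =>
      S.H (Function.update g i 0) φ Z * Complex.exp (Complex.I * ((s : ℂ) * ((ω ^ (k + 1 - (i : ℕ)) / ϱ : ℝ) : ℂ))) :=
    funext fun s => H_update_old_phaseStepVertex S hS g φ Z hi s
  rw [hfun, H_update_old_phaseStepVertex S hS g φ Z hi t]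
  have h1 : HasDerivAt (fun s : ℝ => Complex.I * ((s : ℂ) * ((ω ^ (k + 1 - (i : ℕ)) / ϱ : ℝ) : ℂ)))
      (Complex.I * ((ω ^ (k + 1 - (i : ℕ)) / ϱ : ℝ) : ℂ)) t := by
    simpa using ((HasDerivAt.ofReal_comp (hasDerivAt_id t)).mul_const (((ω ^ (k + 1 - (i : ℕ)) / ϱ : ℝ) : ℂ))).const_mul Complex.I
  exact ((h1.cexp).const_mul _).congr_deriv (by ring)

/-- **THE OLDER-COUPLING SENSITIVITY HAS MODULUS `A e^{−2} e^{−Rd}·(|g_k|∕γ)·ω^{k+1−i}∕ϱ`** — nonzero on the box, fading with the AGE `k+1−i`. [folklore] -/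
theorem norm_deriv_H_old_coord_phaseStepVertex (hA : 0 ≤ A) (hγ : 0 < γ) (hϱ : 0 < ϱ) (hω : 0 < ω) (g : Fin (k + 1) → ℝ) (φ : CPair P 𝔸)
    (Z : (domSys P M (k + 1)).Dom) {i : Fin (k + 1)} (hi : (i : ℕ) < k) (t : ℝ) :
    ‖deriv (fun s : ℝ => S.H (Function.update g i s) φ Z) t‖ =
      A * Real.exp (-2) * Real.exp (-(R * (domSys P M (k + 1)).dj Z)) * (|g (Fin.last k)| / γ) * (ω ^ (k + 1 - (i : ℕ)) / ϱ) := by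
  have hne : Fin.last k ≠ i := by rintro rfl; simp at hi
  rw [(hasDerivAt_H_old_coord_phaseStepVertex S hS g φ Z hi t).deriv, norm_mul, norm_H_phaseStepVertex S hS hA hγ, Function.update_of_ne hne, norm_mul,
    Complex.norm_I, one_mul, Complex.norm_real, Real.norm_eq_abs, abs_of_nonneg (by positivity : (0 : ℝ) ≤ ω ^ (k + 1 - (i : ℕ)) / ϱ)]

/-- **★ g2-vertex's `hOld` AT THE VERTEX PHASE STEP, GEOMETRIC RADII ON THE NOSE.**  For `g` in the box, every polymer, configuration and OLDER coordinate `i < k`: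
`z ↦ H(Z; g|g_i := 0; φ)·e^{i z ω^{k+1−i}∕ϱ}` is holomorphic on the open strip `|Im z| < 2ρ`, `ρ = ϱ·(ω^{k+1−i})⁻¹` (containing the closed `ρ`-discs about `]0, γ]`),
bounded there by `A e^{−R d_{k+1}(Z)}` (`g_k∕γ ≤ 1` on the box, `|e^{izf}| ≤ e²` as `f·ρ = 1`), restricting to `t ↦ H(Z; g|g_i := t; φ)` (`A ≥ 0`, `γ, ϱ, ω > 0`).
[cite: Balaban1987RG1, §1 p.263; Balaban1988RG2Cluster, Lemma 3 (2.38) p.20] -/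
theorem coordHoloOld_phaseStepVertex (hA : 0 ≤ A) (hγ : 0 < γ) (hϱ : 0 < ϱ) (hω : 0 < ω) (sp : (domSys P M (k + 1)).Dom → Set (CPair P 𝔸)) :
    ∀ g ∈ box γ k, ∀ Z, ∀ φ ∈ sp Z, ∀ i : Fin (k + 1), (i : ℕ) < k →
      ∃ (Hc : ℂ → ℂ) (O : Set ℂ), DifferentiableOn ℂ Hc O ∧
        (∀ t ∈ Ioc (0 : ℝ) γ, closedBall (t : ℂ) (ϱ * (ω ^ (k + 1 - (i : ℕ)))⁻¹) ⊆ O) ∧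
        (∀ z ∈ O, ‖Hc z‖ ≤ A * Real.exp (-(R * (domSys P M (k + 1)).dj Z))) ∧
        (∀ t ∈ Ioc (0 : ℝ) γ, Hc t = S.H (Function.update g i t) φ Z) := by
  intro g hg Z φ _ i hi
  have hne : Fin.last k ≠ i := by rintro rfl; simp at hi
  set f : ℝ := ω ^ (k + 1 - (i : ℕ)) / ϱ with hf_def
  set ρ : ℝ := ϱ * (ω ^ (k + 1 - (i : ℕ)))⁻¹ with hρ_def
  have hf : 0 ≤ f := by positivity
  have hρ : 0 < ρ := by positivity
  have hfρ : ρ * f = 1 := by rw [hf_def, hρ_def]; field_simp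
  have hgk : 0 < g (Fin.last k) ∧ g (Fin.last k) ≤ γ := hg (Fin.last k)
  refine ⟨fun z => S.H (Function.update g i 0) φ Z * Complex.exp (Complex.I * (z * (f : ℂ))), {z : ℂ | |z.im| < 2 * ρ}, ?_, ?_, ?_, ?_⟩
  · exact ((differentiable_const _).mul (((differentiable_id.mul_const _).const_mul _).cexp)).differentiableOn
  · intro t _ z hz
    rw [mem_closedBall, dist_eq_norm] at hz
    have him : |z.im| ≤ ρ := by
      calc |z.im| = |(z - (t : ℂ)).im| := by simp
        _ ≤ ‖z - (t : ℂ)‖ := Complex.abs_im_le_norm _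
        _ ≤ ρ := hz
    show |z.im| < 2 * ρ
    linarith
  · intro z hz
    have hexp : ‖Complex.exp (Complex.I * (z * (f : ℂ)))‖ ≤ Real.exp 2 := by
      have h := norm_cexp_I_mul_mul_ofReal_le hf (le_of_lt hz)
      rwa [show 2 * ρ * f = 2 by rw [mul_assoc, hfρ, mul_one]] at h
    have hq : |Function.update g i 0 (Fin.last k)| / γ ≤ 1 := by
      rw [Function.update_of_ne hne, abs_of_pos hgk.1, div_le_one hγ]; exact hgk.2
    rw [norm_mul, norm_H_phaseStepVertex S hS hA hγ]
    calc _ ≤ A * Real.exp (-2) * Real.exp (-(R * (domSys P M (k + 1)).dj Z)) * 1 * Real.exp 2 :=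
          mul_le_mul (mul_le_mul_of_nonneg_left hq (by positivity)) hexp (norm_nonneg _) (by positivity)
      _ = A * Real.exp (-(R * (domSys P M (k + 1)).dj Z)) := by rw [Real.exp_neg]; field_simp
  · intro t _
    rw [H_update_old_phaseStepVertex S hS g φ Z hi t]

/-- **★ g2-vertex's `hLast` AT THE VERTEX PHASE STEP: THE RELATIVE-DISC DATUM IN THE LAST COUPLING.**  For `g` in the box, every polymer and configuration: the ENTIRE map
`z ↦ z·(A e^{−2} e^{−Rd}∕γ)·e^{iθ_old(g)}` (`O = ℂ`) is bounded on each relative disc `D̄(s, c·s)`, `s ∈ ]0, γ]`, by `A′·s·e^{−R d}` with `A′ = A e^{−2}(1+c)∕γ`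
(`|z| ≤ (1+c)s`) and restricts to `t ↦ H(Z; g|g_k := t; φ)` — print's dilation shape: the bound VANISHES LINEARLY at the vertex, no uniform margin (`A ≥ 0`, `γ > 0`, any `c`).
[cite: Balaban1987RG1, §1 p.263 («(or analytic)» in g_{j−1}); Balaban1988RG2Cluster, (2.14) p.15 and Lemma 3 (2.38) p.20] -/
theorem coordHoloLast_phaseStepVertex (hA : 0 ≤ A) (hγ : 0 < γ) (c : ℝ) (sp : (domSys P M (k + 1)).Dom → Set (CPair P 𝔸)) :
    ∀ g ∈ box γ k, ∀ Z, ∀ φ ∈ sp Z,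
      ∃ (Hc : ℂ → ℂ) (O : Set ℂ), DifferentiableOn ℂ Hc O ∧ (∀ s ∈ Ioc (0 : ℝ) γ, closedBall (s : ℂ) (c * s) ⊆ O) ∧
        (∀ s ∈ Ioc (0 : ℝ) γ, ∀ z ∈ closedBall (s : ℂ) (c * s),
          ‖Hc z‖ ≤ A * Real.exp (-2) * (1 + c) / γ * s * Real.exp (-(R * (domSys P M (k + 1)).dj Z))) ∧
        (∀ t ∈ Ioc (0 : ℝ) γ, Hc t = S.H (Function.update g (Fin.last k) t) φ Z) := by
  intro g _ Z φ _
  refine ⟨fun z => z * (((A * Real.exp (-2) * Real.exp (-(R * (domSys P M (k + 1)).dj Z)) / γ : ℝ) : ℂ) *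
      Complex.exp (Complex.I * ((∑ j : Fin (k + 1), Function.update g (Fin.last k) 0 j *
        (if (j : ℕ) < k then ω ^ (k + 1 - (j : ℕ)) / ϱ else 0) : ℝ) : ℂ))), univ, ?_, fun _ _ => subset_univ _, ?_, ?_⟩
  · exact (differentiable_id.mul_const _).differentiableOn
  · intro s hs z hz
    rw [mem_closedBall, dist_eq_norm] at hz
    have hzle : ‖z‖ ≤ (1 + c) * s := by
      calc ‖z‖ = ‖(z - (s : ℂ)) + (s : ℂ)‖ := by rw [sub_add_cancel]
        _ ≤ ‖z - (s : ℂ)‖ + ‖(s : ℂ)‖ := norm_add_le _ _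
        _ ≤ c * s + s := add_le_add hz (by rw [Complex.norm_real, Real.norm_eq_abs, abs_of_pos hs.1])
        _ = (1 + c) * s := by ring
    rw [norm_mul, norm_mul, norm_cexp_I_mul_ofReal, mul_one, Complex.norm_real, Real.norm_eq_abs, abs_of_nonneg (by positivity)]
    calc ‖z‖ * (A * Real.exp (-2) * Real.exp (-(R * (domSys P M (k + 1)).dj Z)) / γ)
        ≤ (1 + c) * s * (A * Real.exp (-2) * Real.exp (-(R * (domSys P M (k + 1)).dj Z)) / γ) :=
          mul_le_mul_of_nonneg_right hzle (by positivity)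
      _ = A * Real.exp (-2) * (1 + c) / γ * s * Real.exp (-(R * (domSys P M (k + 1)).dj Z)) := by ring
  · intro t _
    rw [H_update_last_phaseStepVertex S hS g φ Z t]

end Step

section Config
variable {P : Params} {𝔸 : Type*} [NormedRing 𝔸] [NormedAlgebra ℂ 𝔸] {M k : ℕ} (S : ClusterStep P 𝔸 M k) {A R ϱ ω γ : ℝ}
variable (hS : ∀ (g : Fin (k + 1) → ℝ) (φ : CPair P 𝔸) (Z : (domSys P M (k + 1)).Dom),
  S.H g φ Z = ((A * Real.exp (-2) * Real.exp (-(R * (domSys P M (k + 1)).dj Z)) * (g (Fin.last k) / γ) : ℝ) : ℂ) *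
    Complex.exp (Complex.I * ((∑ i : Fin (k + 1), g i * (if (i : ℕ) < k then ω ^ (k + 1 - (i : ℕ)) / ϱ else 0) : ℝ) : ℂ)))
include hS

/-- W1's configuration slots at the vertex phase step — the PRINTED `AnalyticH` ([II] p.15) on ANY tables and `LocalizedH` — hold trivially: the activity does
not read the configuration (declared; the same one-line reasons as `PhaseTower.analyticH_phaseStep` ∕ `localizedH_phaseStep` for the box tower).
[cite: Balaban1988RG2Cluster, p.15 (analyticity statement) and (2.9) p.14] -/
theorem analyticH_and_localizedH_phaseStepVertex (Wk : Set (Fin (k + 1) → ℝ)) (sp : (domSys P M (k + 1)).Dom → Set (CPair P 𝔸)) :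
    S.AnalyticH Wk sp ∧ S.LocalizedH := by
  refine ⟨fun g _ Z => ?_, fun g Z φ ψ _ => by rw [hS, hS]⟩
  simp only [hS]
  exact analyticOnNhd_const

end Config

/-! ## §2 The vertex phase TOWER on the `K`-th torus: g2-vertex's two data, ★ `NE9 ∧ FadingMemory`, the letter-block face -/

section Tower
variable (F : T4Family) (K : ℕ) {𝔸 : Type*} {M : ℕ} (S : ClusterTower (F.P K) 𝔸 M) {A R ϱ ω γ : ℝ}
variable (hS : ∀ (k : ℕ) (g : Fin (k + 1) → ℝ) (φ : CPair (F.P K) 𝔸) (Z : (domSys (F.P K) M (k + 1)).Dom),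
  (S k).H g φ Z = ((A * Real.exp (-2) * Real.exp (-(R * (domSys (F.P K) M (k + 1)).dj Z)) * (g (Fin.last k) / γ) : ℝ) : ℂ) *
    Complex.exp (Complex.I * ((∑ i : Fin (k + 1), g i * (if (i : ℕ) < k then ω ^ (k + 1 - (i : ℕ)) / ϱ else 0) : ℝ) : ℂ)))
include hS

/-- **g2-vertex's `hOld` AT THE TOWER, VERBATIM, radius table `ρ n i = ϱ·(ω^{n−i})⁻¹`** (the growth hypothesis `i + 1 < n → ϱ·(ω^{n−i})⁻¹ ≤ ρ n i` holds with equality).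
[cite: Balaban1987RG1, §1 p.263; Balaban1988RG2Cluster, (2.38) p.20] -/
theorem coordHoloOld_phaseTowerVertex (hA : 0 ≤ A) (hγ : 0 < γ) (hϱ : 0 < ϱ) (hω : 0 < ω)
    (sp : (k : ℕ) → (domSys (F.P K) M (k + 1)).Dom → Set (CPair (F.P K) 𝔸)) :
    ∀ k, ∀ g ∈ box γ k, ∀ Z, ∀ φ ∈ sp k Z, ∀ i : Fin (k + 1), (i : ℕ) < k →
      ∃ (Hc : ℂ → ℂ) (O : Set ℂ), DifferentiableOn ℂ Hc O ∧
        (∀ t ∈ Ioc (0 : ℝ) γ, closedBall (t : ℂ) ((fun n i : ℕ => ϱ * (ω ^ (n - i))⁻¹) (k + 1) i) ⊆ O) ∧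
        (∀ z ∈ O, ‖Hc z‖ ≤ A * Real.exp (-(R * (domSys (F.P K) M (k + 1)).dj Z))) ∧
        (∀ t ∈ Ioc (0 : ℝ) γ, Hc t = (S k).H (Function.update g i t) φ Z) :=
  fun k => coordHoloOld_phaseStepVertex (S k) (hS k) hA hγ hϱ hω (sp k)

/-- **g2-vertex's `hLast` AT THE TOWER, VERBATIM**, amplitude `A′ = A e^{−2}(1+c)∕γ`. [cite: Balaban1987RG1, §1 p.263; Balaban1988RG2Cluster, (2.14) p.15] -/
theorem coordHoloLast_phaseTowerVertex (hA : 0 ≤ A) (hγ : 0 < γ) (c : ℝ)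
    (sp : (k : ℕ) → (domSys (F.P K) M (k + 1)).Dom → Set (CPair (F.P K) 𝔸)) :
    ∀ k, ∀ g ∈ box γ k, ∀ Z, ∀ φ ∈ sp k Z,
      ∃ (Hc : ℂ → ℂ) (O : Set ℂ), DifferentiableOn ℂ Hc O ∧ (∀ s ∈ Ioc (0 : ℝ) γ, closedBall (s : ℂ) (c * s) ⊆ O) ∧
        (∀ s ∈ Ioc (0 : ℝ) γ, ∀ z ∈ closedBall (s : ℂ) (c * s),
          ‖Hc z‖ ≤ A * Real.exp (-2) * (1 + c) / γ * s * Real.exp (-(R * (domSys (F.P K) M (k + 1)).dj Z))) ∧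
        (∀ t ∈ Ioc (0 : ℝ) γ, Hc t = (S k).H (Function.update g (Fin.last k) t) φ Z) :=
  fun k => coordHoloLast_phaseStepVertex (S k) (hS k) hA hγ c (sp k)

open Classical in
/-- **★★ g2's VERTEX ★ FIRES ON A NON-TERMLESS TOWER.**  For the vertex phase tower on the `K`-th torus, ANY pairing, background type and reading (space tables `univ`),
slope `c > 0`, Road 1's numerals with the vertex amplitude `A′ = A e^{−2}(1+c)∕γ` (`0 < A`, `0 < γ`, `0 ≤ r₁`, `κ ≤ r₁`, `r₁ + 2·64·log 162 + 2 ≤ R`,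
`2·(A′γ)·e^{5r₁+1}·K₀(64,8)·9·64 ≤ 1`), `0 < ϱ`, `0 < ω ≤ 1`: node N22's SHAPE holds for `W1.functionalOn S p emb` with the VERTEX table
`Λ n i = c₀·(if i+1<n then 4A∕(ϱ·(ω^{n−i})⁻¹) else 8A′∕min(c,1))`, `FadingMemory (c₀·max (4A∕ϱ) (8A′∕min(c,1)∕ω)) ω Λ`, `c₀ = 8·e·9·64·K₀(64,8)²` — by
`ne9_and_fadingMemory_functionalOn_of_coordHoloRadii_vertex` (p609043) on `coordHoloOld∕Last_phaseTowerVertex`; here the activities read EVERY coupling, the last one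
LINEARLY (`H_update_last_injective_…`, `norm_deriv_H_old_coord_…`).  A model tower, NOT NODE 00's; NO uniform last-coupling margin anywhere.
[cite: Balaban1987RG1, §1 p.263 and §5 p.298; Balaban1988RG2Cluster, (2.13)-(2.14) pp.14-15 and (2.38) p.20] -/
theorem ne9_and_fadingMemory_phaseTowerVertex (p : RunPairing) {B : Type} (emb : B → CPair (F.P K) 𝔸) {κ r₁ c : ℝ} (hA : 0 < A) (hγ : 0 < γ)
    (hr₁ : 0 ≤ r₁) (hκ : κ ≤ r₁) (hrate : r₁ + 2 * (64 * Real.log 162) + 2 ≤ R)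
    (hsmall : 2 * (A * Real.exp (-2) * (1 + c) / γ * γ) * Real.exp (5 * r₁ + 1) * K₀ 64 8 * 9 * 64 ≤ 1) (hϱ : 0 < ϱ) (hω : 0 < ω) (hω1 : ω ≤ 1)
    (hc : 0 < c) :
    NE9 (functionalOn S p emb) (Window γ) κ
        (fun n i => 8 * (Real.exp 1 * 9 * 64 * K₀ 64 8 ^ 2) *
          (if i + 1 < n then 4 * A / (ϱ * (ω ^ (n - i))⁻¹) else 8 * (A * Real.exp (-2) * (1 + c) / γ) / min c 1)) ∧
      FadingMemory (8 * (Real.exp 1 * 9 * 64 * K₀ 64 8 ^ 2) * max (4 * A / ϱ) (8 * (A * Real.exp (-2) * (1 + c) / γ) / min c 1 / ω)) ω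
        (fun n i => 8 * (Real.exp 1 * 9 * 64 * K₀ 64 8 ^ 2) *
          (if i + 1 < n then 4 * A / (ϱ * (ω ^ (n - i))⁻¹) else 8 * (A * Real.exp (-2) * (1 + c) / γ) / min c 1)) :=
  ne9_and_fadingMemory_functionalOn_of_coordHoloRadii_vertex F K S p emb (fun _ _ => univ) (fun _ _ _ => mem_univ _) hA.le (by positivity) hγ hr₁ hκ hrate
    hsmall hϱ hω hω1 hc (fun n i => ϱ * (ω ^ (n - i))⁻¹) (fun _ _ => mul_pos hϱ (inv_pos.2 (pow_pos hω _))) (fun _ _ _ => le_rfl)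
    (coordHoloOld_phaseTowerVertex F K S hS hA.le hγ hϱ hω fun _ _ => univ)
    (coordHoloLast_phaseTowerVertex F K S hS hA.le hγ c fun _ _ => univ)

end Tower

section LetterFace
variable (F : T4Family) (K : ℕ) {𝔸 : Type*} {M : ℕ} (S : ClusterTower (F.P K) 𝔸 M) (ℓ : U3Letters₁₁) {A R ϱ γ : ℝ}
variable (hS : ∀ (k : ℕ) (g : Fin (k + 1) → ℝ) (φ : CPair (F.P K) 𝔸) (Z : (domSys (F.P K) M (k + 1)).Dom),
  (S k).H g φ Z = ((A * Real.exp (-2) * Real.exp (-(R * (domSys (F.P K) M (k + 1)).dj Z)) * (g (Fin.last k) / γ) : ℝ) : ℂ) *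
    Complex.exp (Complex.I * ((∑ i : Fin (k + 1), g i * (if (i : ℕ) < k then ℓ.ω ^ (k + 1 - (i : ℕ)) / ϱ else 0) : ℝ) : ℂ)))
include hS

open Classical in
/-- **THE `ℓ.moduli` FACE AT THE VERTEX PHASE TOWER** tuned to a letter block's rate `ℓ.ω ≤ 1`: with `c₀·max (4A∕ϱ) (8A′∕min(c,1)∕ℓ.ω) ≤ ℓ.C₉`,
`NE9 (W1.functionalOn S p emb) (Window γ) κ ℓ.moduli` — g2-vertex's `ne9_functionalOn_letterModuli_of_coordHoloRadii_vertex` on the two data.  A model tower.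
[cite: Balaban1987RG1, (1.20)-(1.22) p.264 and §5 p.298] -/
theorem ne9_letterModuli_phaseTowerVertex (p : RunPairing) {B : Type} (emb : B → CPair (F.P K) 𝔸) {κ r₁ c : ℝ} (hA : 0 < A) (hγ : 0 < γ) (hr₁ : 0 ≤ r₁)
    (hκ : κ ≤ r₁) (hrate : r₁ + 2 * (64 * Real.log 162) + 2 ≤ R)
    (hsmall : 2 * (A * Real.exp (-2) * (1 + c) / γ * γ) * Real.exp (5 * r₁ + 1) * K₀ 64 8 * 9 * 64 ≤ 1) (hϱ : 0 < ϱ) (hc : 0 < c) (hω : 0 < ℓ.ω)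
    (hω1 : ℓ.ω ≤ 1) (hC₉ : 8 * (Real.exp 1 * 9 * 64 * K₀ 64 8 ^ 2) * max (4 * A / ϱ) (8 * (A * Real.exp (-2) * (1 + c) / γ) / min c 1 / ℓ.ω) ≤ ℓ.C₉) :
    NE9 (functionalOn S p emb) (Window γ) κ ℓ.moduli :=
  ne9_functionalOn_letterModuli_of_coordHoloRadii_vertex F K S p emb (fun _ _ => univ) (fun _ _ _ => mem_univ _) hA.le (by positivity) hγ hr₁ hκ hrate hsmall
    hϱ hc ℓ hω hω1 (fun n i => ϱ * (ℓ.ω ^ (n - i))⁻¹) (fun _ _ => mul_pos hϱ (inv_pos.2 (pow_pos hω _))) (fun _ _ _ => le_rfl) hC₉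
    (coordHoloOld_phaseTowerVertex F K S hS hA.le hγ hϱ hω fun _ _ => univ)
    (coordHoloLast_phaseTowerVertex F K S hS hA.le hγ c fun _ _ => univ)

end LetterFace

/-! ## §3 A realisation (one term per polymer) and the packaged A6 statement at the vertex -/

section Realisation
variable (P : Params) (𝔸 : Type*) (M : ℕ)

/-- **A VERTEX PHASE TOWER EXISTS** on any torus: at every step `k` the `ClusterStep` with index type `𝐃_{k+1}`, `idx Z = {Z}` (EXACTLY ONE multi-index per polymer) and
term `T(Z) = A e^{−2} e^{−R d(Z)}·(g_k∕γ)·e^{iΣ_{i<k} g_i ω^{k+1−i}∕ϱ}` realises the activity formula of §1–§2. [folklore] -/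
theorem exists_phaseTowerVertex (A R ϱ ω γ : ℝ) :
    ∃ S : ClusterTower P 𝔸 M, (∀ k Z, ((S k).idx Z).card = 1) ∧
      ∀ (k : ℕ) (g : Fin (k + 1) → ℝ) (φ : CPair P 𝔸) (Z : (domSys P M (k + 1)).Dom),
        (S k).H g φ Z = ((A * Real.exp (-2) * Real.exp (-(R * (domSys P M (k + 1)).dj Z)) * (g (Fin.last k) / γ) : ℝ) : ℂ) *
          Complex.exp (Complex.I * ((∑ i : Fin (k + 1), g i * (if (i : ℕ) < k then ω ^ (k + 1 - (i : ℕ)) / ϱ else 0) : ℝ) : ℂ)) := by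
  refine ⟨fun k => ⟨(domSys P M (k + 1)).Dom, fun Z => {Z}, fun Z g _ =>
    ((A * Real.exp (-2) * Real.exp (-(R * (domSys P M (k + 1)).dj Z)) * (g (Fin.last k) / γ) : ℝ) : ℂ) *
      Complex.exp (Complex.I * ((∑ i : Fin (k + 1), g i * (if (i : ℕ) < k then ω ^ (k + 1 - (i : ℕ)) / ϱ else 0) : ℝ) : ℂ))⟩,
    fun k Z => Finset.card_singleton Z, fun k g φ Z => ?_⟩
  show ∑ i ∈ ({Z} : Finset _), _ = _
  rw [Finset.sum_singleton]

end Realisation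

section Packaged
variable (F : T4Family) (K : ℕ) (𝔸 : Type*) (M : ℕ)

open Classical in
/-- **★★ PACKAGED A6 AT THE VERTEX — NODE N22's VERTEX SHAPE ON A TOWER THAT READS EVERY COUPLING, THE LAST ONE LINEARLY.**  Under the numerals of
`ne9_and_fadingMemory_phaseTowerVertex`, for any pairing, background type, reading map: THERE IS a cluster tower on the `K`-th torus with (i) EXACTLY ONE multi-index per
polymer, (ii) activities of modulus `A e^{−2} e^{−R d(Z)}·|g_k|∕γ` (nonzero on the box), (iii) activities INJECTIVE in the last coupling, (iv) node N22's vertex shape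
`NE9 … Λ ∧ FadingMemory (c₀·max (4A∕ϱ) (8A′∕min(c,1)∕ω)) ω Λ` with the vertex table.  g2-vertex ★'s antecedent inhabited NON-degenerately; a model tower, NOT NODE 00's;
no uniform last-coupling margin anywhere. [cite: Balaban1987RG1, §1 p.263 and §5 p.298; Balaban1988RG2Cluster, (2.13)-(2.14) pp.14-15 and (2.38) p.20] -/
theorem exists_nonTermless_ne9_and_fadingMemory_vertex (p : RunPairing) {B : Type} (emb : B → CPair (F.P K) 𝔸) {γ κ A R r₁ ϱ ω c : ℝ}
    (hA : 0 < A) (hγ : 0 < γ) (hr₁ : 0 ≤ r₁) (hκ : κ ≤ r₁) (hrate : r₁ + 2 * (64 * Real.log 162) + 2 ≤ R)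
    (hsmall : 2 * (A * Real.exp (-2) * (1 + c) / γ * γ) * Real.exp (5 * r₁ + 1) * K₀ 64 8 * 9 * 64 ≤ 1) (hϱ : 0 < ϱ) (hω : 0 < ω) (hω1 : ω ≤ 1)
    (hc : 0 < c) :
    ∃ S : ClusterTower (F.P K) 𝔸 M,
      (∀ k Z, ((S k).idx Z).card = 1) ∧
      (∀ (k : ℕ) (g : Fin (k + 1) → ℝ) (φ : CPair (F.P K) 𝔸) (Z : (domSys (F.P K) M (k + 1)).Dom),
        ‖(S k).H g φ Z‖ = A * Real.exp (-2) * Real.exp (-(R * (domSys (F.P K) M (k + 1)).dj Z)) * (|g (Fin.last k)| / γ)) ∧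
      (∀ (k : ℕ) (g : Fin (k + 1) → ℝ) (φ : CPair (F.P K) 𝔸) (Z : (domSys (F.P K) M (k + 1)).Dom),
        Function.Injective fun t : ℝ => (S k).H (Function.update g (Fin.last k) t) φ Z) ∧
      (NE9 (functionalOn S p emb) (Window γ) κ
          (fun n i => 8 * (Real.exp 1 * 9 * 64 * K₀ 64 8 ^ 2) *
            (if i + 1 < n then 4 * A / (ϱ * (ω ^ (n - i))⁻¹) else 8 * (A * Real.exp (-2) * (1 + c) / γ) / min c 1)) ∧
        FadingMemory (8 * (Real.exp 1 * 9 * 64 * K₀ 64 8 ^ 2) * max (4 * A / ϱ) (8 * (A * Real.exp (-2) * (1 + c) / γ) / min c 1 / ω)) ω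
          (fun n i => 8 * (Real.exp 1 * 9 * 64 * K₀ 64 8 ^ 2) *
            (if i + 1 < n then 4 * A / (ϱ * (ω ^ (n - i))⁻¹) else 8 * (A * Real.exp (-2) * (1 + c) / γ) / min c 1))) := by
  obtain ⟨S, hcard, hS⟩ := exists_phaseTowerVertex (F.P K) 𝔸 M A R ϱ ω γ
  exact ⟨S, hcard, fun k => norm_H_phaseStepVertex (S k) (hS k) hA.le hγ,
    fun k g φ Z => H_update_last_injective_phaseStepVertex (S k) (hS k) hA hγ g φ Z,
    ne9_and_fadingMemory_phaseTowerVertex F K S hS p emb hA hγ hr₁ hκ hrate hsmall hϱ hω hω1 hc⟩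

end Packaged

end YMDAG.N22.W1.CouplingRadii.PhaseTowerVertex

end
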